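import Mathlib.Dynamics.Circle.RotationNumber.TranslationNumber
import Mathlib.Analysis.Calculus.ContDiff.Defs
import Mathlib.Analysis.Calculus.Deriv.Basic
import Mathlib.Analysis.SpecialFunctions.Pow.Real
import HarnessLib

/-!
# Smooth linearisation of circle diffeomorphisms with Diophantine rotation number (Herman–Yoccoz)

Topic `Literature/Dynamics/Circle` (mirrors `Mathlib.Dynamics.Circle`). One NAMED FACT (D-0014), no proofs:
the global smooth-conjugacy theorem of Herman (1979) and Yoccoz (1984) for orientation-preserving
`C^∞` diffeomorphisms of the circle `T¹ = ℝ/ℤ` whose rotation number satisfies a Diophantine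
condition, in Yoccoz's optimal form ([Yoccoz1984], p. 335, THÉORÈME + COROLLAIRE, the `C^∞` case:
"Soit `f ∈ D^k(T¹)`, `k` entier, `k ≥ 3`. On suppose qu'il existe `β ≥ 0` tel que `α` appartient à
`C_β`. Alors, si `k > 2β+1`, il existe un difféomorphisme `h ∈ D¹(T¹)` qui conjugue `f` à `R_α` …
COROLLAIRE. — Sous les mêmes hypothèses sur `α`, `h` est de classe `C^∞` si `f` est de classe `C^∞`").

Encoding (all of it Yoccoz's own, p. 333–334): one works in the universal cover, `D^r(T¹)` = the
group of `C^r` diffeomorphisms `f` of the real line with `f − id` `ℤ`-periodic — here a Mathlib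
`CircleDeg1Lift` (monotone, `f (x + 1) = f x + 1`) that is `C^∞` with everywhere positive
derivative; `R_a : x ↦ x + a`; the rotation number `ρ(f) ∈ ℝ` of `f ∈ D⁰(T¹)` is Poincaré's, i.e.
Mathlib's `CircleDeg1Lift.translationNumber`; "`α` vérifie une condition diophantienne d'ordre `β`"
(`α ∈ C_β`) iff `∃ C > 0, |α − p/q| ≥ C / q^{2+β}` for every rational `p/q`; the Diophantine numbers
are `⋃_{β ≥ 0} C_β`. "`h` conjugue `f` à `R_α`" is stated as `f ∘ h = h ∘ R_α`; since `h ∈ D^∞(T¹)`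
iff `h⁻¹ ∈ D^∞(T¹)`, the other reading `h ∘ f = R_α ∘ h` gives an equivalent existence statement.

Deliberately NOT here: the finite-differentiability statement (`h ∈ C^{k−1−β−ε}`, Hölder scale),
the analytic case, Herman's measure-theoretic version, the Arnold–Moser local theorem, and the
optimality half (`𝒜 ⊆ ⋃ C_β`, [Yoccoz1984] p. 334 citing Herman ch. XI). Mathlib (this pin) has
`CircleDeg1Lift`, `translationNumber`, its basic properties and Denjoy-free existence results, but
no smooth-conjugacy theorem (searched `[Hh]erman|[Yy]occoz|[Dd]enjoy`, `translationNumber.*ContDiff`: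
nothing); the tree had no `Literature/Dynamics/Circle` before this file.

Filed by a grounder for route `SmoothPoincare4/DiophantineRotations` (its thesis is "Herman–Yoccoz
rigidity two dimensions up"): this is the dimension-one case of the rigidity asked for in
`Summit.SmoothPoincare4.SmoothPoincare4.Theses.DiophantineRotations.DiophantineRigidity`, recorded as
the nearest theorem in print; it does not close that item.
-/

namespace Literature.Dynamics.Circle

/-- **Herman–Yoccoz theorem** (global smooth linearisation, `C^∞` case), [Yoccoz1984] p. 335
THÉORÈME + COROLLAIRE: let `f` be an orientation-preserving `C^∞` diffeomorphism of `T¹ = ℝ/ℤ`,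
given by a lift `f ∈ D^∞(T¹)` (a `C^∞` map `ℝ → ℝ` with `f − id` `ℤ`-periodic and `f' > 0`), whose
rotation number `α = ρ(f)` satisfies a Diophantine condition of some order `β ≥ 0`
(`∃ C > 0, ∀ p/q ∈ ℚ, |α − p/q| ≥ C/q^{2+β}`). Then `f` is `C^∞`-conjugate to the translation
`R_α : x ↦ x + α`: there is `h ∈ D^∞(T¹)` with `f ∘ h = h ∘ R_α`.
(Yoccoz proves `h ∈ D¹ ∩ C^{k−1−β−ε}` for `f ∈ D^k`, `k > 2β+1`; the corollary is the `C^∞` case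
stated here. Grounds — as nearest print, dimension one — the crux
`Summit.SmoothPoincare4.SmoothPoincare4.Theses.DiophantineRotations.DiophantineRigidity`.)
[cite: Yoccoz1984, p. 335 Théorème and Corollaire] -/
def yoccoz1984_smoothConjugacy_of_diophantine : Prop :=
  ∀ f : CircleDeg1Lift, ContDiff ℝ (⊤ : ℕ∞) (⇑f) → (∀ x : ℝ, 0 < deriv (⇑f) x) →
    (∃ β C : ℝ, 0 ≤ β ∧ 0 < C ∧
      ∀ (p : ℤ) (q : ℕ), 0 < q → C / (q : ℝ) ^ (2 + β) ≤ |f.translationNumber - p / q|) →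
    ∃ h : CircleDeg1Lift, ContDiff ℝ (⊤ : ℕ∞) (⇑h) ∧ (∀ x : ℝ, 0 < deriv (⇑h) x) ∧
      ∀ x : ℝ, f (h x) = h (x + f.translationNumber)

end Literature.Dynamics.Circle
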